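import Summits.Schanuel.Schanuel.Theorems.RootDecomp1ELWTransport03

/-!
# RootDecomp1ELWTransport — lens 2, generation 39 «LW-PAIR NORM TRANSPORT CELL» (lane E-R18 (a)): S ITSELF on the class `InLWClass` (E-doubled moment curves over a dyadic 2-fold-hyper-Liouville T), engine `algebraicIndependent_lwPt` mod `hLW : LWMeasure` — continuation (RootDecomp1ELWTransport04): §3 `DyadicHyper₂`, `endgame_lw`, `ably_exponent_le`, `transport_factor_le` and bookkeeping

(lens-2 g39 `LWTransport.lean` [HOME/decomp-schanuel-lens-2/g39/ sha256 cff5d88d…e8f0, 2208 l; NODE L1907 / REQUEST L1908; critic VERDICT L1909 (CLEARED, E-R18 (a) cell credit, port GO)]; port by census-1 gen 17 as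
`RootDecomp1ELWTransport01`–`09` — see the PORT NOTE of part 01; `--supports stmt-Schanuel-31409`; rung 0.)
-/

noncomputable section

open Complex Polynomial
open Literature.NumberTheory.Transcendental (zlen zlen_nonneg zlen_add_le zlen_monomial_le zlen_sum_le
  zlen_mul_le zlen_pow_le)

namespace Summit.Schanuel.Schanuel.Theorems.RootDecomp1ELWTransport

open Summit.Schanuel.Schanuel.Theorems.RootDecomp1KHyper (SB SFset sb_of_algebraicIndependent LWMeasure
  exists_ball_eval_ne_zero exists_int_mul_eq_map mvaeval_int_map)
open Summit.Schanuel.Schanuel.Theorems.RootDecomp1KHyper.HyperCell (Ewt exC collPoly collPoly_ne_zero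
  exC_inj)
open NormDescent (P2)

variable {k : ℕ}

/-! ## §3  The transport theorem

**Budget.**  At the approximant `p/q`, `q = 2^μ`, the collapsed `A ∈ ℤ[U,V]` has `deg A ≤ N := d(p+q)^k`,
`length(A) ≤ (p+q)^d length(P)` and `|A(u,v)| ≤ q^d K |T − p/q|`.  After `μk` descent steps
(`2^{μk} = q^k =: Q`) the polynomial `g := descend (μk) A` has `deg g ≤ Q N`, `length(g) ≤ length(A)^{Q²}`
and `|g(e, e^β)| ≤ |A(u,v)| · length(A)^{Q²} · R^{3QN}` (`R = e^{1+|β|}`).  Ably's measure at the FIXED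
pair `y = (1, β)` gives `|g(e,e^β)| ≥ exp(−c₂ D²(log H + e^{C D² log(D+1)}))` with `D = QN`,
`log H ≍ Q² log length(A)`: the right-hand side is `exp(−exp(c · q^{6k+3}))` for a constant `c`
depending on `P, T, β, k` AND on Ably's opaque `C, c₂` — which is why the class must beat
`exp(−exp(q^m))` for EVERY `m` (∀μ-robust at the double-exponential level): a single-exponential
(hyper-Liouville) hypothesis cannot absorb the unknown `C`. -/

/-- **Dyadic 2-fold hyper-Liouville reals**: for every `m` there is a dyadic `p/2^μ ≠ T`, `μ ≥ m`, with
`|T − p/2^μ| < exp(−exp(2^{mμ})) = exp(−exp((2^μ)^m))`.  Explicit members: `T⋆` of §4.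
(An explicit, Lebesgue-null, dense set of Liouville numbers.) -/
def DyadicHyper₂ (T : ℝ) : Prop :=
  ∀ m : ℕ, ∃ μ p : ℕ, m ≤ μ ∧ T ≠ (p : ℝ) / 2 ^ μ ∧
    |T - (p : ℝ) / 2 ^ μ| < Real.exp (-Real.exp ((2 : ℝ) ^ (m * μ)))

/-- `x ≤ Real.exp x` (for `(x : ℝ)`). -/
private theorem le_exp_self (x : ℝ) : x ≤ Real.exp x := by linarith [Real.add_one_le_exp x]

/-- `x ^ n ≤ Real.exp (n * x)` (for `{x : ℝ} (hx : 0 ≤ x) (n : ℕ)`). -/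
private theorem pow_le_exp_mul {x : ℝ} (hx : 0 ≤ x) (n : ℕ) : x ^ n ≤ Real.exp (n * x) := by
  rw [Real.exp_nat_mul]; exact pow_le_pow_left₀ hx (le_exp_self x) n

/-- `s i ≤ P.totalDegree`. -/
private theorem apply_le_totalDegree {σ : Type*} {P : MvPolynomial σ ℤ} {s : σ →₀ ℕ}
    (hs : s ∈ P.support) (i : σ) : s i ≤ P.totalDegree := by
  refine le_trans ?_ (MvPolynomial.le_totalDegree hs)
  by_cases hi : i ∈ s.support
  · exact Finset.single_le_sum (f := fun j => s j) (fun _ _ => Nat.zero_le _) hi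
  · simp [Finsupp.notMem_support_iff.mp hi]

/-- `|((Q.coeff m : ℤ) : ℝ)| ≤ zlen Q` (for `{σ : Type*} (Q : MvPolynomial σ ℤ) (m : σ →₀ ℕ)`). -/
private theorem abs_coeff_le_zlen {σ : Type*} (Q : MvPolynomial σ ℤ) (m : σ →₀ ℕ) :
    |((Q.coeff m : ℤ) : ℝ)| ≤ zlen Q := by
  by_cases hm : m ∈ Q.support
  · rw [zlen]
    exact Finset.single_le_sum (f := fun s => |((Q.coeff s : ℤ) : ℝ)|) (fun _ _ => abs_nonneg _) hm
  · rw [MvPolynomial.notMem_support_iff.mp hm, Int.cast_zero, abs_zero]; exact zlen_nonneg Q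

/-- `1 ≤ zlen f` (for `{σ : Type*} {f : MvPolynomial σ ℤ} (hf : f ≠ 0)`). -/
private theorem one_le_zlen' {σ : Type*} {f : MvPolynomial σ ℤ} (hf : f ≠ 0) : 1 ≤ zlen f := by
  obtain ⟨m, hm⟩ := MvPolynomial.ne_zero_iff.mp hf
  exact le_trans (by exact_mod_cast Int.one_le_abs hm) (abs_coeff_le_zlen f m)

/-- **Endgame** of the transport: the double-exponential budget. -/
theorem endgame_lw {Φ X η g a q : ℝ} {m e : ℕ} (hX0 : 0 ≤ X)
    (hlow : Real.exp (-Φ) ≤ g) (hup : g ≤ X * η) (hη : η < Real.exp (-Real.exp (q ^ m)))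
    (hΦ : Φ ≤ Real.exp (a * q ^ e)) (hX : X ≤ Real.exp (Real.exp (a * q ^ e)))
    (hq1 : 1 ≤ q) (haq : a + 1 ≤ q) (hme : e + 1 ≤ m) : False := by
  have h1 : Real.exp (-Φ) ≤ X * Real.exp (-Real.exp (q ^ m)) :=
    hlow.trans (hup.trans (mul_le_mul_of_nonneg_left hη.le hX0))
  have h2 : Real.exp (-Φ) ≤ Real.exp (Real.exp (a * q ^ e) - Real.exp (q ^ m)) := by
    rw [Real.exp_sub, div_eq_mul_inv, ← Real.exp_neg]
    exact h1.trans (mul_le_mul_of_nonneg_right hX (Real.exp_pos _).le)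
  have h3 : -Φ ≤ Real.exp (a * q ^ e) - Real.exp (q ^ m) := Real.exp_le_exp.mp h2
  have h4 : Real.exp (q ^ m) ≤ 2 * Real.exp (a * q ^ e) := by linarith
  have h5 : 2 * Real.exp (a * q ^ e) < Real.exp (a * q ^ e + 1) := by
    rw [Real.exp_add]
    have := Real.exp_one_gt_d9
    nlinarith [Real.exp_pos (a * q ^ e)]
  have h6 : q ^ m < a * q ^ e + 1 := Real.exp_lt_exp.mp (h4.trans_lt h5)
  have hq0 : 0 ≤ q := by linarith
  have h7 : a * q ^ e + 1 ≤ q ^ m := by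
    have hqe : 1 ≤ q ^ e := one_le_pow₀ hq1
    calc a * q ^ e + 1 ≤ a * q ^ e + q ^ e := by linarith
      _ = (a + 1) * q ^ e := by ring
      _ ≤ q * q ^ e := mul_le_mul_of_nonneg_right haq (pow_nonneg hq0 _)
      _ = q ^ (e + 1) := by ring
      _ ≤ q ^ m := pow_le_pow_right₀ hq1 hme
  linarith

/-- The two collapsed base points `u = e^{1/q^k}`, `v = e^{β/q^k}` and their `2^j`-th powers,
`2^j ≤ q^k`, have modulus `≤ e^{1+|β|}`. -/
theorem norm_basePair_pow_le {q k j : ℕ} (β : ℂ) (hQpos : (0 : ℝ) < (q : ℝ) ^ k)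
    (h2j : (2 : ℝ) ^ j ≤ (q : ℝ) ^ k) (i : Fin 2) :
    ‖(![cexp (((q : ℂ) ^ k)⁻¹), cexp (β * ((q : ℂ) ^ k)⁻¹)] i) ^ 2 ^ j‖ ≤ Real.exp (1 + ‖β‖) := by
  have hratio : (2 : ℝ) ^ j / (q : ℝ) ^ k ≤ 1 := by rw [div_le_one hQpos]; exact h2j
  have hratio0 : 0 ≤ (2 : ℝ) ^ j / (q : ℝ) ^ k := by positivity
  have hcR1 : (1 : ℝ) ≤ 1 + ‖β‖ := by linarith [norm_nonneg β]
  rcases Fin.exists_fin_two.mp ⟨i, rfl⟩ with h | h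
  · rw [h]
    simp only [Matrix.cons_val_zero]
    rw [← Complex.exp_nat_mul, Complex.norm_exp]
    have hre : ((2 ^ j : ℕ) * ((q : ℂ) ^ k)⁻¹ : ℂ).re = (2 : ℝ) ^ j / (q : ℝ) ^ k := by
      have : ((2 ^ j : ℕ) * ((q : ℂ) ^ k)⁻¹ : ℂ) = (((2 : ℝ) ^ j / (q : ℝ) ^ k : ℝ) : ℂ) := by
        push_cast; ring
      rw [this, Complex.ofReal_re]
    rw [hre]
    exact Real.exp_le_exp.mpr (hratio.trans hcR1)
  · rw [h]
    simp only [Matrix.cons_val_one, Matrix.cons_val_zero]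
    rw [← Complex.exp_nat_mul, Complex.norm_exp]
    have hre : ((2 ^ j : ℕ) * (β * ((q : ℂ) ^ k)⁻¹) : ℂ).re =
        (2 : ℝ) ^ j / (q : ℝ) ^ k * β.re := by
      have : ((2 ^ j : ℕ) * (β * ((q : ℂ) ^ k)⁻¹) : ℂ) =
          (((2 : ℝ) ^ j / (q : ℝ) ^ k : ℝ) : ℂ) * β := by
        push_cast; ring
      rw [this, Complex.re_ofReal_mul]
    rw [hre]
    refine Real.exp_le_exp.mpr ?_
    have hb' : |β.re| ≤ ‖β‖ := Complex.abs_re_le_norm β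
    calc (2 : ℝ) ^ j / (q : ℝ) ^ k * β.re ≤ (2 : ℝ) ^ j / (q : ℝ) ^ k * |β.re| :=
          mul_le_mul_of_nonneg_left (le_abs_self _) hratio0
      _ ≤ 1 * ‖β‖ := mul_le_mul hratio hb' (abs_nonneg _) zero_le_one
      _ ≤ 1 + ‖β‖ := by rw [one_mul]; exact le_add_of_nonneg_left zero_le_one

/-- Bookkeeping (i): Ably's exponent at the descended polynomial is `≤ exp(2 a₁ B³)`
(`B = q^{2k+1}`, `D' ≤ c_N B`, `log H ≤ (c_A + 1) B`). -/
theorem ably_exponent_le {C c₂ cN cA B D' lH a₁ : ℝ} (hC : 0 < C) (hc₂ : 0 < c₂) (hcN0 : 0 ≤ cN)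
    (hcA0 : 0 ≤ cA) (hB1 : 1 ≤ B) (hD'0 : 0 ≤ D') (hD'r : D' ≤ cN * B) (hlH0 : 0 ≤ lH)
    (hlH : lH ≤ (cA + 1) * B) (ha₁ : a₁ = 2 * c₂ * cN ^ 2 + (cA + 1 + C * cN ^ 2 * (cN + 1))) :
    c₂ * D' ^ 2 * (lH + Real.exp (C * D' ^ 2 * Real.log (D' + 1))) ≤
      Real.exp (2 * a₁ * B ^ 3) := by
  have hB0 : 0 ≤ B := by linarith
  have hB3 : B ≤ B ^ 3 := le_self_pow₀ hB1 (by norm_num)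
  have hB30 : 0 ≤ B ^ 3 := by positivity
  have hlogD : Real.log (D' + 1) ≤ (cN + 1) * B := by
    calc Real.log (D' + 1) ≤ D' + 1 := by
          have := Real.log_le_sub_one_of_pos (show (0 : ℝ) < D' + 1 by positivity); linarith
      _ ≤ cN * B + B := by linarith
      _ = (cN + 1) * B := by ring
  have hlogD0 : 0 ≤ Real.log (D' + 1) := Real.log_nonneg (by linarith)
  have hD'2 : D' ^ 2 ≤ cN ^ 2 * B ^ 2 := by
    rw [← mul_pow]; exact pow_le_pow_left₀ hD'0 hD'r 2
  have hinner : C * D' ^ 2 * Real.log (D' + 1) ≤ C * cN ^ 2 * (cN + 1) * B ^ 3 := by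
    calc C * D' ^ 2 * Real.log (D' + 1)
        ≤ C * (cN ^ 2 * B ^ 2) * ((cN + 1) * B) :=
          mul_le_mul (mul_le_mul_of_nonneg_left hD'2 hC.le) hlogD hlogD0 (by positivity)
      _ = C * cN ^ 2 * (cN + 1) * B ^ 3 := by ring
  have p1 : 0 ≤ 2 * c₂ * cN ^ 2 := by positivity
  have p2 : 0 ≤ C * cN ^ 2 * (cN + 1) := by positivity
  have p3 : 0 ≤ cA + 1 := by positivity
  have hc6 : cA + 1 ≤ a₁ ∧ C * cN ^ 2 * (cN + 1) ≤ a₁ ∧ 2 * c₂ * cN ^ 2 ≤ a₁ :=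
    ⟨by rw [ha₁]; linarith only [p1, p2], by rw [ha₁]; linarith only [p1, p3],
      by rw [ha₁]; linarith only [p2, p3]⟩
  have h1 : lH ≤ Real.exp (a₁ * B ^ 3) :=
    calc lH ≤ (cA + 1) * B := hlH
      _ ≤ (cA + 1) * B ^ 3 := mul_le_mul_of_nonneg_left hB3 (by positivity)
      _ ≤ a₁ * B ^ 3 := mul_le_mul_of_nonneg_right hc6.1 hB30
      _ ≤ Real.exp (a₁ * B ^ 3) := le_exp_self _
  have h2 : Real.exp (C * D' ^ 2 * Real.log (D' + 1)) ≤ Real.exp (a₁ * B ^ 3) :=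
    Real.exp_le_exp.mpr (hinner.trans (mul_le_mul_of_nonneg_right hc6.2.1 hB30))
  have h3 : c₂ * D' ^ 2 ≤ c₂ * cN ^ 2 * B ^ 3 := by
    calc c₂ * D' ^ 2 ≤ c₂ * (cN ^ 2 * B ^ 2) := mul_le_mul_of_nonneg_left hD'2 hc₂.le
      _ ≤ c₂ * (cN ^ 2 * B ^ 3) := mul_le_mul_of_nonneg_left
          (mul_le_mul_of_nonneg_left (pow_le_pow_right₀ hB1 (by norm_num)) (sq_nonneg cN)) hc₂.le
      _ = c₂ * cN ^ 2 * B ^ 3 := by ring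
  have h4 : 2 * (c₂ * cN ^ 2 * B ^ 3) ≤ Real.exp (a₁ * B ^ 3) :=
    calc 2 * (c₂ * cN ^ 2 * B ^ 3) = (2 * c₂ * cN ^ 2) * B ^ 3 := by ring
      _ ≤ a₁ * B ^ 3 := mul_le_mul_of_nonneg_right hc6.2.2 hB30
      _ ≤ Real.exp (a₁ * B ^ 3) := le_exp_self _
  have hE0 := Real.exp_pos (a₁ * B ^ 3)
  calc c₂ * D' ^ 2 * (lH + Real.exp (C * D' ^ 2 * Real.log (D' + 1)))
      ≤ (c₂ * cN ^ 2 * B ^ 3) * (Real.exp (a₁ * B ^ 3) + Real.exp (a₁ * B ^ 3)) :=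
        mul_le_mul h3 (add_le_add h1 h2) (add_nonneg hlH0 (Real.exp_pos _).le) (by positivity)
    _ = (2 * (c₂ * cN ^ 2 * B ^ 3)) * Real.exp (a₁ * B ^ 3) := by ring
    _ ≤ Real.exp (a₁ * B ^ 3) * Real.exp (a₁ * B ^ 3) := mul_le_mul_of_nonneg_right h4 hE0.le
    _ = Real.exp (2 * a₁ * B ^ 3) := by rw [← Real.exp_add]; ring_nf

/-- Bookkeeping (ii): the transport factor `q^d · K · length(A)^{4^n} · R^{3·2^n·deg A}` is
`≤ exp(a₂ B³)`. -/
theorem transport_factor_le {q B cN cA cR Kl ZA R a₂ : ℝ} {d k n dA : ℕ} (hq0 : 0 ≤ q)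
    (hqB : q ≤ B) (hB1 : 1 ≤ B) (hKl0 : 0 ≤ Kl) (hcA0 : 0 ≤ cA) (hcN0 : 0 ≤ cN) (hcR0 : 0 ≤ cR)
    (hZA0 : 0 ≤ ZA) (hR : R = Real.exp cR) (hZApow : ZA ^ 4 ^ n ≤ Real.exp (cA * B))
    (h2n : (2 : ℝ) ^ n = q ^ k) (hdeg : (dA : ℝ) ≤ cN * q ^ k) (hqkB : q ^ k * q ^ k ≤ B)
    (ha₂ : a₂ = (d : ℝ) + Kl + cA + 3 * cR * cN) :
    q ^ d * Kl * (ZA ^ 4 ^ n * R ^ (3 * 2 ^ n * dA)) ≤ Real.exp (a₂ * B ^ 3) := by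
  have hd0 : (0 : ℝ) ≤ d := Nat.cast_nonneg d
  have hB3 : B ≤ B ^ 3 := le_self_pow₀ hB1 (by norm_num)
  have hB30 : 0 ≤ B ^ 3 := by positivity
  have hR1 : 1 ≤ R := by rw [hR]; exact Real.one_le_exp hcR0
  have hqk0 : 0 ≤ q ^ k := pow_nonneg hq0 k
  have h1 : q ^ d ≤ Real.exp (d * B ^ 3) :=
    calc q ^ d ≤ Real.exp (d * q) := pow_le_exp_mul hq0 d
      _ ≤ Real.exp (d * B ^ 3) := Real.exp_le_exp.mpr (mul_le_mul_of_nonneg_left (hqB.trans hB3) hd0)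
  have h2 : Kl ≤ Real.exp (Kl * B ^ 3) :=
    (le_exp_self Kl).trans (Real.exp_le_exp.mpr (le_mul_of_one_le_right hKl0 (one_le_pow₀ hB1)))
  have h3 : ZA ^ 4 ^ n ≤ Real.exp (cA * B ^ 3) :=
    hZApow.trans (Real.exp_le_exp.mpr (mul_le_mul_of_nonneg_left hB3 hcA0))
  have h4 : R ^ (3 * 2 ^ n * dA) ≤ Real.exp (3 * cR * cN * B ^ 3) := by
    rw [hR, ← Real.exp_nat_mul]
    refine Real.exp_le_exp.mpr ?_
    push_cast
    rw [h2n]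
    calc 3 * q ^ k * (dA : ℝ) * cR ≤ 3 * q ^ k * (cN * q ^ k) * cR := by gcongr
      _ = 3 * cR * cN * (q ^ k * q ^ k) := by ring
      _ ≤ 3 * cR * cN * B ^ 3 := mul_le_mul_of_nonneg_left (hqkB.trans hB3) (by positivity)
  calc q ^ d * Kl * (ZA ^ 4 ^ n * R ^ (3 * 2 ^ n * dA))
      ≤ Real.exp (d * B ^ 3) * Real.exp (Kl * B ^ 3) *
        (Real.exp (cA * B ^ 3) * Real.exp (3 * cR * cN * B ^ 3)) :=
        mul_le_mul (mul_le_mul h1 h2 hKl0 (Real.exp_pos _).le)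
          (mul_le_mul h3 h4 (pow_nonneg (zero_le_one.trans hR1) _) (Real.exp_pos _).le)
          (mul_nonneg (pow_nonneg hZA0 _) (pow_nonneg (zero_le_one.trans hR1) _)) (by positivity)
    _ = Real.exp (a₂ * B ^ 3) := by
        rw [← Real.exp_add, ← Real.exp_add, ← Real.exp_add, ha₂]; ring_nf

end Summit.Schanuel.Schanuel.Theorems.RootDecomp1ELWTransport

end
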